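import Literature.NumberTheory.LFunctions.Zhang2022.RepairBedLadderCertificates
import HarnessLib

/-!
# Zhang (2022) rescue bed (D-0124 (3)): kernel certificates for the DEEP rungs of the all-inert ladder —
# `D_47^− = −1 333 963`, `D_53^− = D_59^− = −2 404 147`, `D_61^+ = 2 004 917`

Topic `Literature/NumberTheory/LFunctions/Zhang2022` (Landau–Siegel audit tree; verdict-neutral), cell landau-siegel, LS RESCUE
PROTOCOL (D-0124) part (3) GENUINE BED, typer seat ls-rescue-typ-1. **Nothing here is a claim about Landau–Siegel zeros; the
programme SEARCHES and TYPES; no claim about Landau–Siegel zeros, Theorems 1–2 of arXiv:2211.02515 or a repaired Margin232 until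
a kernel theorem says so.**

Continuation of `RepairBedLadderCertificates.lean` (rule `L1y` of bed-1's spec `bed1-KG1-v0.1`: `D_y^s` = the fundamental
discriminant of sign `s`, `|D| > 4`, least in absolute value with every prime `p ≤ y` inert, `IsLeastAllInert y s D`; kernel
ladder there: `y ≤ 43` on the negative side, `y ≤ 59` on the positive side, by `≤ 4·10⁴`-wide `decide +kernel` sweeps of the
`ZMod`-valued check `allInertCheck`). The next rungs need sweeps over `> 10⁶` integers, out of reach of that check (≈ 30 s per
4·10⁴). This file replaces it, for sweeping purposes only, by

* `inertPowTest p r` — Euler's criterion `r^{(p−1)/2} ≡ −1 (mod p)` evaluated in `ℕ` (kernel GMP arithmetic), and the twins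
  `allInertCheckNeg y N` / `allInertCheckPos y N` of `allInertCheck y (∓N)` with **`allInertCheckNeg_eq`**, **`allInertCheckPos_eq`**
  (proved equal, via `ZMod.natCast_mod` and `((m : ZMod p) = −1) ↔ m % p = p − 1`);
* the prefilter `allInertCheckNeg_of_mod_ne` / `allInertCheckPos_of_mod_ne`: only `N ≡ 3 (mod 8)` resp. `N ≡ 5 (mod 8)` can pass
  (`2` inert), so a sweep need only visit one residue class mod `8`;
* `sweep8 f s n` — the Boolean certificate «`f (s + 8m) = false` for all `m < n`» with `sweep8_sound`, and the interval forms
  `allInertCheck_neg_false_of_sweep8` / `allInertCheck_pos_false_of_sweep8`;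
* fundamentality of the deep rungs by the finite square-freeness check: `isFundamentalDiscriminant_negN` for the eight negative
  rungs `N = 1 333 963`, `2 404 147`, `20 950 603`, `36 254 563 = 127·285 469`, `51 599 563`, `96 295 483`, `114 148 483 = 101·463·2441`,
  `269 497 867 = 317·419·2029`, and `isFundamentalDiscriminant_pos2004917` — the referents the bed's class-number-formula files
  (`RepairBedClassNumberFormulaNegDeep`, `…RealDeep`) consume;
* THE RUNGS: `sweep47_neg`, **`isLeastAllInert_neg1333963`** (`y = 47`); `sweep53_neg`, **`isLeastAllInert_neg2404147`** (`y = 53, 59`);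
  `sweep61_pos`, **`isLeastAllInert_pos2004917`** (`y = 61`) — each by ONE stride-8 certificate (`1.6·10⁵`, `1.3·10⁵`, `2.2·10⁵`
  evaluations) on top of the lower rung's sweep (`allInertCheck_false_mono`). Kernel ladder after this file: `y ≤ 59` (−),
  `y ≤ 61` (+), i.e. 29 of the 50 `(y, sign)` rows of the bed's list are exact kernel theorems (engines A ≡ B on all 50).

## References

* [LehmerLehmerShanks1970] D. H. Lehmer, E. Lehmer, D. Shanks, *Integer sequences having prescribed quadratic character*,
  Math. Comp. 24 (1970) 433–451, §1 and Tables.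
* [MontgomeryVaughan2007] H. L. Montgomery, R. C. Vaughan, *Multiplicative Number Theory I* (2007), §9.3 (Euler's criterion).
-/

namespace Literature.NumberTheory.LFunctions.Zhang2022.Repair.Bed

open Literature.Barriers.RiemannHypothesis (IsFundamentalDiscriminant)

/-! ## Euler's criterion in `ℕ` arithmetic -/

/-- Euler's criterion for «`p` inert», tested in `ℕ`: `r^{⌊p/2⌋} mod p = p − 1`. [cite: MontgomeryVaughan2007, §9.3] -/
def inertPowTest (p r : ℕ) : Bool := r ^ (p / 2) % p == p - 1

/-- The all-inert check for the NEGATIVE discriminant `D = −N` in `ℕ` arithmetic: `N ≡ 3 (mod 8)` (i.e. `D ≡ 5 (mod 8)`, if `y ≥ 2`)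
and `(−N)^{(p−1)/2} ≡ −1 (mod p)` for every odd prime `p ≤ y` (heights `y ≤ 101`), with `−N ≡ (p − N mod p) mod p`.
[cite: LehmerLehmerShanks1970, §1] -/
def allInertCheckNeg (y N : ℕ) : Bool :=
  (!(decide (2 ≤ y)) || N % 8 == 3) &&
    (oddPrimesUpTo101.filter (· ≤ y)).all fun p => inertPowTest p ((p - N % p) % p)

/-- The all-inert check for the POSITIVE discriminant `D = N` in `ℕ` arithmetic: `N ≡ 5 (mod 8)` (if `y ≥ 2`) and
`N^{(p−1)/2} ≡ −1 (mod p)` for every odd prime `p ≤ y`. [cite: LehmerLehmerShanks1970, §1] -/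
def allInertCheckPos (y N : ℕ) : Bool :=
  (!(decide (2 ≤ y)) || N % 8 == 5) &&
    (oddPrimesUpTo101.filter (· ≤ y)).all fun p => inertPowTest p (N % p)

/-- Every member of `oddPrimesUpTo101` is `≥ 3`. [folklore] -/
private theorem three_le_of_mem_oddPrimesUpTo101 {p : ℕ} (hp : p ∈ oddPrimesUpTo101) : 3 ≤ p := by
  have h : ∀ q ∈ oddPrimesUpTo101, 3 ≤ q := by decide
  exact h p hp

/-- In `ZMod p` (`p ≥ 2`): `(m : ZMod p) = −1 ⟺ m mod p = p − 1`. [cite: MontgomeryVaughan2007, §9.3] -/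
theorem natCast_zmod_eq_neg_one_iff {p : ℕ} (hp : 2 ≤ p) (m : ℕ) : ((m : ZMod p) = -1) ↔ m % p = p - 1 := by
  have : NeZero p := ⟨by omega⟩
  have e : ((p - 1 : ℕ) : ZMod p) = -1 := by
    rw [Nat.cast_sub (by omega), ZMod.natCast_self, Nat.cast_one, zero_sub]
  rw [← e, ZMod.natCast_eq_natCast_iff, Nat.ModEq, Nat.mod_eq_of_lt (by omega : p - 1 < p)]

/-- The `ℕ` test agrees with the `ZMod` test on any representative. [cite: MontgomeryVaughan2007, §9.3] -/
private theorem inertPowTest_eq {p r : ℕ} (hp : 2 ≤ p) {x : ZMod p} (hx : (r : ZMod p) = x) :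
    inertPowTest p r = decide (x ^ (p / 2) = -1) := by
  rw [inertPowTest, ← hx, ← Nat.cast_pow, Bool.eq_iff_iff, beq_iff_eq, decide_eq_true_eq,
    natCast_zmod_eq_neg_one_iff hp]

/-- **The positive `ℕ` check IS the ladder check**: `allInertCheckPos y N = allInertCheck y N`. [cite: LehmerLehmerShanks1970, §1] -/
theorem allInertCheckPos_eq (y N : ℕ) : allInertCheckPos y N = allInertCheck y (N : ℤ) := by
  unfold allInertCheckPos allInertCheck
  congr 1
  · congr 1
    rw [Bool.eq_iff_iff, beq_iff_eq, decide_eq_true_eq]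
    omega
  · rw [Bool.eq_iff_iff, List.all_eq_true, List.all_eq_true]
    refine forall₂_congr fun p hp => ?_
    have h3 := three_le_of_mem_oddPrimesUpTo101 (List.mem_filter.1 hp).1
    have : NeZero p := ⟨by omega⟩
    have hx : ((N % p : ℕ) : ZMod p) = (((N : ℤ) : ℤ) : ZMod p) := by
      rw [ZMod.natCast_mod, Int.cast_natCast]
    rw [inertPowTest_eq (by omega) hx]

/-- **The negative `ℕ` check IS the ladder check**: `allInertCheckNeg y N = allInertCheck y (−N)`. [cite: LehmerLehmerShanks1970, §1] -/
theorem allInertCheckNeg_eq (y N : ℕ) : allInertCheckNeg y N = allInertCheck y (-(N : ℤ)) := by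
  unfold allInertCheckNeg allInertCheck
  congr 1
  · congr 1
    rw [Bool.eq_iff_iff, beq_iff_eq, decide_eq_true_eq]
    omega
  · rw [Bool.eq_iff_iff, List.all_eq_true, List.all_eq_true]
    refine forall₂_congr fun p hp => ?_
    have h3 := three_le_of_mem_oddPrimesUpTo101 (List.mem_filter.1 hp).1
    have : NeZero p := ⟨by omega⟩
    have hx : (((p - N % p) % p : ℕ) : ZMod p) = ((-(N : ℤ) : ℤ) : ZMod p) := by
      rw [ZMod.natCast_mod, Nat.cast_sub (Nat.mod_lt N (by omega)).le, ZMod.natCast_self, zero_sub,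
        ZMod.natCast_mod, Int.cast_neg, Int.cast_natCast]
    rw [inertPowTest_eq (by omega) hx]

/-- Prefilter: at heights `y ≥ 2` only `N ≡ 3 (mod 8)` can pass the negative check. [cite: LehmerLehmerShanks1970, §1] -/
theorem allInertCheckNeg_of_mod_ne {y N : ℕ} (hy : 2 ≤ y) (h : N % 8 ≠ 3) : allInertCheckNeg y N = false := by
  have h1 : (N % 8 == 3) = false := beq_eq_false_iff_ne.mpr h
  simp [allInertCheckNeg, hy, h1]

/-- Prefilter: at heights `y ≥ 2` only `N ≡ 5 (mod 8)` can pass the positive check. [cite: LehmerLehmerShanks1970, §1] -/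
theorem allInertCheckPos_of_mod_ne {y N : ℕ} (hy : 2 ≤ y) (h : N % 8 ≠ 5) : allInertCheckPos y N = false := by
  have h1 : (N % 8 == 5) = false := beq_eq_false_iff_ne.mpr h
  simp [allInertCheckPos, hy, h1]

/-! ## Stride-8 sweep certificates -/

/-- The Boolean certificate «`f (s + 8m) = false` for every `m < n`» (structural recursion, evaluated by `decide +kernel`).
[cite: LehmerLehmerShanks1970, §1] -/
def sweep8 (f : ℕ → Bool) (s : ℕ) : ℕ → Bool
  | 0 => true
  | n + 1 => !(f (s + 8 * n)) && sweep8 f s n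

/-- Soundness of `sweep8`. [cite: LehmerLehmerShanks1970, §1] -/
theorem sweep8_sound {f : ℕ → Bool} {s n : ℕ} (h : sweep8 f s n = true) {m : ℕ} (hm : m < n) :
    f (s + 8 * m) = false := by
  induction n with
  | zero => omega
  | succ n ih =>
    simp only [sweep8, Bool.and_eq_true, Bool.not_eq_true'] at h
    rcases Nat.lt_succ_iff_lt_or_eq.1 hm with hm | rfl
    · exact ih h.2 hm
    · exact h.1

/-- **Interval form, negative side**: a stride-8 certificate from `8m₀ + 3` of length `n` at height `2 ≤ y` shows that EVERY
`N` with `8m₀ + 3 ≤ N < 8(m₀ + n) + 3` fails `allInertCheck y (−N)` (the other residues mod `8` fail at the prime `2`).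
[cite: LehmerLehmerShanks1970, §1] -/
theorem allInertCheck_neg_false_of_sweep8 {y m₀ n : ℕ} (hy : 2 ≤ y)
    (h : sweep8 (allInertCheckNeg y) (8 * m₀ + 3) n = true) {N : ℕ} (h1 : 8 * m₀ + 3 ≤ N) (h2 : N < 8 * (m₀ + n) + 3) :
    allInertCheck y (-(N : ℤ)) = false := by
  rw [← allInertCheckNeg_eq]
  by_cases hN : N % 8 = 3
  · obtain ⟨m, rfl⟩ : ∃ m, N = 8 * m₀ + 3 + 8 * m := ⟨(N - (8 * m₀ + 3)) / 8, by omega⟩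
    exact sweep8_sound h (by omega)
  · exact allInertCheckNeg_of_mod_ne hy hN

/-- **Interval form, positive side**: a stride-8 certificate from `8m₀ + 5` of length `n` at height `2 ≤ y` shows that EVERY
`N` with `8m₀ + 5 ≤ N < 8(m₀ + n) + 5` fails `allInertCheck y N`. [cite: LehmerLehmerShanks1970, §1] -/
theorem allInertCheck_pos_false_of_sweep8 {y m₀ n : ℕ} (hy : 2 ≤ y)
    (h : sweep8 (allInertCheckPos y) (8 * m₀ + 5) n = true) {N : ℕ} (h1 : 8 * m₀ + 5 ≤ N) (h2 : N < 8 * (m₀ + n) + 5) :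
    allInertCheck y (N : ℤ) = false := by
  rw [← allInertCheckPos_eq]
  by_cases hN : N % 8 = 5
  · obtain ⟨m, rfl⟩ : ∃ m, N = 8 * m₀ + 5 + 8 * m := ⟨(N - (8 * m₀ + 5)) / 8, by omega⟩
    exact sweep8_sound h (by omega)
  · exact allInertCheckPos_of_mod_ne hy hN

/-! ## Fundamentality of the deep rungs (finite square-freeness checks) -/

/-- Boolean trial check «no `x` with `2 ≤ x ≤ B` has `x² ∣ n`» (structural recursion; evaluated by `decide +kernel`). [folklore] -/
def sqfreeUpTo (n : ℕ) : ℕ → Bool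
  | 0 => true
  | B + 1 => (decide (B + 1 < 2) || !(n % ((B + 1) * (B + 1)) == 0)) && sqfreeUpTo n B

/-- Soundness of `sqfreeUpTo`. [folklore] -/
private theorem sqfreeUpTo_sound {n : ℕ} : ∀ {B : ℕ}, sqfreeUpTo n B = true → ∀ x ≤ B, 2 ≤ x → ¬ x * x ∣ n
  | 0, _, x, hx, h2, _ => by omega
  | B + 1, h, x, hx, h2, hdvd => by
    simp only [sqfreeUpTo, Bool.and_eq_true, Bool.or_eq_true, decide_eq_true_eq, Bool.not_eq_true',
      beq_eq_false_iff_ne] at h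
    rcases Nat.lt_succ_iff_lt_or_eq.1 (Nat.lt_succ_of_le hx) with hx' | rfl
    · exact sqfreeUpTo_sound h.2 x (by omega) h2 hdvd
    · rcases h.1 with h1 | h1
      · omega
      · exact h1 (Nat.mod_eq_zero_of_dvd hdvd)

/-- A finite square-freeness certificate: if `|z| ≠ 0`, `|z| < (B+1)²` and `sqfreeUpTo |z| B`, then `z` is square-free
(cf. the private helper of `RepairBedModuli`). [folklore] -/
private theorem squarefree_int_of_sqfreeUpTo (z : ℤ) (B : ℕ) (h0 : z.natAbs ≠ 0) (hB : z.natAbs < (B + 1) * (B + 1))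
    (h : sqfreeUpTo z.natAbs B = true) : Squarefree z := by
  rw [← Int.squarefree_natAbs, Nat.squarefree_iff_prime_squarefree]
  intro x hx hdvd
  have hle : x * x ≤ z.natAbs := Nat.le_of_dvd (Nat.pos_of_ne_zero h0) hdvd
  have hxB : x ≤ B := by
    by_contra hxB
    have hBx : B + 1 ≤ x := by omega
    have : (B + 1) * (B + 1) ≤ x * x := Nat.mul_self_le_mul_self hBx
    omega
  exact sqfreeUpTo_sound h x hxB hx.two_le hdvd

/-- `D_47^− = −1 333 963` (prime) is a fundamental discriminant (`≡ 1 (mod 4)`, square-free by finite check).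
[cite: LehmerLehmerShanks1970, §1] -/
theorem isFundamentalDiscriminant_neg1333963 : IsFundamentalDiscriminant (-1333963) :=
  Or.inl ⟨by decide, squarefree_int_of_sqfreeUpTo _ 1154 (by decide) (by decide) (by decide +kernel), by decide⟩

/-- `D_53^− = D_59^− = −2 404 147` (prime) is a fundamental discriminant. [cite: LehmerLehmerShanks1970, §1] -/
theorem isFundamentalDiscriminant_neg2404147 : IsFundamentalDiscriminant (-2404147) :=
  Or.inl ⟨by decide, squarefree_int_of_sqfreeUpTo _ 1550 (by decide) (by decide) (by decide +kernel), by decide⟩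

/-- `D_61^− = −20 950 603` (prime) is a fundamental discriminant. [cite: LehmerLehmerShanks1970, §1] -/
theorem isFundamentalDiscriminant_neg20950603 : IsFundamentalDiscriminant (-20950603) :=
  Or.inl ⟨by decide, squarefree_int_of_sqfreeUpTo _ 4577 (by decide) (by decide) (by decide +kernel), by decide⟩

/-- `D_67^− = −36 254 563 = −127·285 469` is a fundamental discriminant. [cite: LehmerLehmerShanks1970, §1] -/
theorem isFundamentalDiscriminant_neg36254563 : IsFundamentalDiscriminant (-36254563) :=
  Or.inl ⟨by decide, squarefree_int_of_sqfreeUpTo _ 6021 (by decide) (by decide) (by decide +kernel), by decide⟩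

/-- `D_71^− = −51 599 563` (prime) is a fundamental discriminant. [cite: LehmerLehmerShanks1970, §1] -/
theorem isFundamentalDiscriminant_neg51599563 : IsFundamentalDiscriminant (-51599563) :=
  Or.inl ⟨by decide, squarefree_int_of_sqfreeUpTo _ 7183 (by decide) (by decide) (by decide +kernel), by decide⟩

/-- `D_73^− = D_79^− = −96 295 483` (prime) is a fundamental discriminant. [cite: LehmerLehmerShanks1970, §1] -/
theorem isFundamentalDiscriminant_neg96295483 : IsFundamentalDiscriminant (-96295483) :=
  Or.inl ⟨by decide, squarefree_int_of_sqfreeUpTo _ 9813 (by decide) (by decide) (by decide +kernel), by decide⟩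

/-- `D_83^− = −114 148 483 = −101·463·2441` is a fundamental discriminant. [cite: LehmerLehmerShanks1970, §1] -/
theorem isFundamentalDiscriminant_neg114148483 : IsFundamentalDiscriminant (-114148483) :=
  Or.inl ⟨by decide, squarefree_int_of_sqfreeUpTo _ 10684 (by decide) (by decide) (by decide +kernel), by decide⟩

/-- `D_89^− = D_97^− = D_101^− = −269 497 867 = −317·419·2029` is a fundamental discriminant. [cite: LehmerLehmerShanks1970, §1] -/
theorem isFundamentalDiscriminant_neg269497867 : IsFundamentalDiscriminant (-269497867) :=
  Or.inl ⟨by decide, squarefree_int_of_sqfreeUpTo _ 16416 (by decide) (by decide) (by decide +kernel), by decide⟩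

/-- `D_61^+ = 2 004 917` (prime, `≡ 5 (mod 8)`) is a fundamental discriminant. [cite: LehmerLehmerShanks1970, §1] -/
theorem isFundamentalDiscriminant_pos2004917 : IsFundamentalDiscriminant 2004917 :=
  Or.inl ⟨by decide, squarefree_int_of_sqfreeUpTo _ 1415 (by decide) (by decide) (by decide +kernel), by decide⟩

/-! ## The rung `D_47^− = −1 333 963` -/

/-- Stride-8 certificate at `y = 47`: every `N ≡ 3 (mod 8)` with `77 683 ≤ N ≤ 1 333 955` fails (`157 035` evaluations; the first
of them is the previous rung `77 683`, all-inert to `43` but not at `47`). [cite: LehmerLehmerShanks1970, §1] -/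
theorem sweep47_neg_cert : sweep8 (allInertCheckNeg 47) (8 * 9710 + 3) 157035 = true := by
  decide +kernel

/-- No negative `D'` with `5 ≤ |D'| < 1 333 963` has all primes `≤ 47` inert (below `77 683` the `y = 41` sweep is reused).
[cite: LehmerLehmerShanks1970, §1] -/
theorem sweep47_neg : ∀ D' ∈ Finset.Icc ((-1333963 : ℤ) + 1) (-5), allInertCheck 47 D' = false := by
  intro D' hD'
  rw [Finset.mem_Icc] at hD'
  by_cases h1 : -77682 ≤ D'
  · exact allInertCheck_false_mono (by norm_num) (by norm_num) (sweep41_neg D' (Finset.mem_Icc.mpr ⟨by omega, hD'.2⟩))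
  · obtain ⟨N, rfl⟩ : ∃ N : ℕ, D' = -(N : ℤ) := ⟨D'.natAbs, by omega⟩
    exact allInertCheck_neg_false_of_sweep8 (by norm_num) sweep47_neg_cert (by omega) (by omega)

/-- **`D_47^− = −1 333 963`** (prime; all primes `≤ 47` inert, `53` is not). [cite: LehmerLehmerShanks1970, §1] -/
theorem isLeastAllInert_neg1333963 : IsLeastAllInert 47 (-1) (-1333963) :=
  isLeastAllInert_of_check_neg (by norm_num) isFundamentalDiscriminant_neg1333963
    (by decide) (by decide) (by decide +kernel) sweep47_neg

/-! ## The rung `D_53^− = D_59^− = −2 404 147` -/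

/-- Stride-8 certificate at `y = 53`: every `N ≡ 3 (mod 8)` with `1 333 963 ≤ N ≤ 2 404 139` fails (`133 773` evaluations; the
first is `D_47^−` itself, which fails at `53`). [cite: LehmerLehmerShanks1970, §1] -/
theorem sweep53_neg_cert : sweep8 (allInertCheckNeg 53) (8 * 166745 + 3) 133773 = true := by
  decide +kernel

/-- No negative `D'` with `5 ≤ |D'| < 2 404 147` has all primes `≤ 53` inert. [cite: LehmerLehmerShanks1970, §1] -/
theorem sweep53_neg : ∀ D' ∈ Finset.Icc ((-2404147 : ℤ) + 1) (-5), allInertCheck 53 D' = false := by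
  intro D' hD'
  rw [Finset.mem_Icc] at hD'
  by_cases h1 : -1333962 ≤ D'
  · exact allInertCheck_false_mono (by norm_num) (by norm_num) (sweep47_neg D' (Finset.mem_Icc.mpr ⟨by omega, hD'.2⟩))
  · obtain ⟨N, rfl⟩ : ∃ N : ℕ, D' = -(N : ℤ) := ⟨D'.natAbs, by omega⟩
    exact allInertCheck_neg_false_of_sweep8 (by norm_num) sweep53_neg_cert (by omega) (by omega)

/-- **`D_53^− = D_59^− = −2 404 147`** (prime; all primes `≤ 59` inert, `61` is not). [cite: LehmerLehmerShanks1970, §1] -/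
theorem isLeastAllInert_neg2404147 : IsLeastAllInert 53 (-1) (-2404147) ∧ IsLeastAllInert 59 (-1) (-2404147) := by
  have h53 : IsLeastAllInert 53 (-1) (-2404147) :=
    isLeastAllInert_of_check_neg (by norm_num) isFundamentalDiscriminant_neg2404147
      (by decide) (by decide) (by decide +kernel) sweep53_neg
  exact ⟨h53,
    h53.of_le_of_allInertUpTo (by norm_num) ((allInertUpTo_iff_check (by norm_num) _).mpr (by decide +kernel))⟩

/-! ## The rung `D_61^+ = 2 004 917` -/

/-- Stride-8 certificate at `y = 61`: every `N ≡ 5 (mod 8)` with `214 037 ≤ N ≤ 2 004 909` fails (`223 860` evaluations; the first is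
`D_47^+ = D_59^+ = 214 037`, which fails at `61`). [cite: LehmerLehmerShanks1970, §1] -/
theorem sweep61_pos_cert : sweep8 (allInertCheckPos 61) (8 * 26754 + 5) 223860 = true := by
  decide +kernel

/-- No positive `D' < 2 004 917` (`D' ≥ 5`) has all primes `≤ 61` inert (below `214 037` the `y = 47` sweep is reused).
[cite: LehmerLehmerShanks1970, §1] -/
theorem sweep61_pos : ∀ D' ∈ Finset.Icc 5 ((2004917 : ℤ) - 1), allInertCheck 61 D' = false := by
  intro D' hD'
  rw [Finset.mem_Icc] at hD'
  by_cases h1 : D' ≤ 214036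
  · exact allInertCheck_false_mono (by norm_num) (by norm_num) (sweep47_pos D' (Finset.mem_Icc.mpr ⟨hD'.1, h1⟩))
  · obtain ⟨N, rfl⟩ : ∃ N : ℕ, D' = (N : ℤ) := ⟨D'.natAbs, by omega⟩
    exact allInertCheck_pos_false_of_sweep8 (by norm_num) sweep61_pos_cert (by omega) (by omega)

/-- **`D_61^+ = 2 004 917`** (prime; all primes `≤ 61` inert, `67` is not). [cite: LehmerLehmerShanks1970, §1] -/
theorem isLeastAllInert_pos2004917 : IsLeastAllInert 61 1 2004917 :=
  isLeastAllInert_of_check_pos (by norm_num) isFundamentalDiscriminant_pos2004917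
    (by decide) (by decide) (by decide +kernel) sweep61_pos

end Literature.NumberTheory.LFunctions.Zhang2022.Repair.Bed
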